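import Summits.QuantumFields.YangMills.Theorems.AlphaInputsT3ACv3AdaptedSel
import Summits.QuantumFields.YangMills.Theorems.AlphaInputsT3ACv3LocalSmall
import Summits.QuantumFields.YangMills.Theorems.BalabanUVNodesN08AlphaB7AllScales
import HarnessLib

/-!
# `AlphaInputsT3ACv3AdaptedClassL` — STRATEGY B for 2′: THE **LOCALISED** ADAPTED CLASS `𝒞_L(k, h, W)` (the (D6) repair) — closed on the record's
# window at admissible histories, minimisers by compactness, a MEASURABLE argmin selector, membership ⇒ the rows — lane `pub-balaban3d`, seat alpha-2 (g2)

WHY (located at g2, HOME `D6-AUDIT-alpha2-g2.md`).  Seat g0's class `AlphaInputsT3AC.adaptedClassT3` is cut by two GLOBAL small-loop classes —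
`SubstrateBlockAvgContinuity.NestedSmall ℰp (δ/2) k` (every (0.4) loop variable of every level `< k` on the whole torus) and NODE O's `argClassC k` (every
[4] `log`-argument of every level `< k` on `ℤ³`) — although the rows the v3 socket reads at a non-trivial history evaluate the averages only on the
dependency cones over `Ω_k(h)` ∕ `Λ_i(h)`: print's (42)-minimiser does not control `Ū^i` on `Λ_j` for `i > j`, and NODE O gen 5 itself replaced `argClassC`
by (b7)-continuity on [7]'s class (`…ProfileEnd` §1, `…B7AllScales.hcont_regClass`).  So the displayed non-emptiness (D6) `AdaptedClassNonemptyT3` asks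
for more than the construction needs and more than the tree's regular profiles are known to give.  THIS FILE re-cuts the class:
  `𝒞_L(k,h,W) = NestedSmallOn ℰp (δ/2) E(k,h) k ∩ regClassC 𝔊 𝔠 k h ∩ large67Set k h ∩ {Ũ | ChargedT3 k h W → Ũ ∈ top42Set k h W ∩ reg68LevelsSet k h}`
with `E(k,h)` = the dependency HULL (`LocalSmallLoop.hull`) of the READ BONDS `bondsIn s (lam42 Ω(h) k i)`, `s ≤ i ≤ k` (exactly the bonds rows r2∕r3 read), and
NO `argClassC`: the (67)-set is closed relative to `regClassC` because the lifted [4]-averages at the bonds of `Λ_j(h)` are continuous on [7]'s open class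
(`hcont_regClass`, [Balaban1985Averaging] Prop. 2) — whose three window premises HOLD on the record's window `γ ≤ (min γ₀ 1)²` through `γ₀ ≤ γ₇₁ = γ(σ₆₈)`
(`Thresholds.gamma71L_spec` ∕ `sigma68_spec`), so no new displayed hypothesis enters.  `𝒞 ⊆ 𝒞_L` (`adaptedClassT3_subset_adaptedClassT3L`).
CONTENTS: §1 the window; §2 read bonds, cones, the class; §3 closedness (admissible `h`, `k ≤ K`); §4 ★ `exists_selector_adaptedClassT3L`; §5 membership ⇒ rows.
HONEST FRAMING.  Kinematics∕topology∕measurable selection; nothing of [B10]∕[7]∕[4]'s estimates is asserted beyond the tree's theorem `hcont_regClass`; the class is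
NOT claimed to contain print's minimiser and its non-emptiness is NOT proved here (displayed as (D6L) in the sibling schema).  Count-neutral helper toward
R3 2′ (`stub_laneRecordsV3`, items 19935∕19936); nothing here is a claim about d = 4, the continuum, or a mass gap.

References: T. Bałaban, Commun. Math. Phys. 102 (1985) 255–275 [Balaban1985UV3] ((40)–(42) p.266, (67)–(68) p.273); CMP 98 (1985) 17–51 [Balaban1985Averaging]
(Prop. 2 (54) p.26, (15) p.19); CMP 109 (1987) 249–301 [Balaban1987RG1] ((0.4) p.253); CMP 102 (1985) 277–309 [Balaban1985Variational] (Thm 1 (8) p.279);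
C. D. Aliprantis, K. C. Border, Infinite Dimensional Analysis (2006) Thm 18.19 [AliprantisBorder2006].
-/

set_option autoImplicit false

noncomputable section

namespace Summit.QuantumFields.YangMills.Theorems

open MeasureTheory Set Topology TopologicalSpace
open scoped Matrix Matrix.Norms.L2Operator
open Literature.MeasureTheory.RandomSets
open Literature.MathematicalPhysics.QuantumFieldTheory.Balaban1983to89
open Literature.MathematicalPhysics.QuantumFieldTheory.Balaban1983to89.B10 (pFun)
open Literature.MathematicalPhysics.QuantumFieldTheory.Balaban1983to89.T3ContinuumYM3Torus
open Literature.MathematicalPhysics.QuantumFieldTheory.Balaban1983to89.T3UnitLawDensityEML (ℰp)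
open Literature.MathematicalPhysics.QuantumFieldTheory.Balaban1983to89.T3UnitScaleTilt (θBal)
open Literature.MathematicalPhysics.QuantumFieldTheory.Balaban1983to89.B10Eq38TorusDomains (plaqsIn)
open Literature.MathematicalPhysics.QuantumFieldTheory.Balaban1983to89.B10Eq42TorusConstraint (bondsIn lam42 lam42_self mem_bondsIn_of_mem_plaqsIn)
open Literature.MathematicalPhysics.QuantumFieldTheory.Balaban1985CMP102.Setting
open Summit.QuantumFields.Balaban3D.Carriers
open Summit.QuantumFields.Balaban3D.Proofs.Primitives (AlphaConsts)
open Summit.QuantumFields.Balaban3D.Proofs.LiftBridge (liftCfg)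
open Summit.QuantumFields.Balaban3D.Proofs.TorusLift (projSite zOf)
open Summit.QuantumFields.Balaban3D.Proofs.Run3SmallFactors (codeZ decode_of_mem_disc)
open Summit.QuantumFields.Balaban3D.Proofs.ScalesArithmetic (gk_pos gk_le_one gk_le_gK)
open Summit.QuantumFields.Balaban3D.Proofs.CouplingWindow (pFun_pos)
open Summit.QuantumFields.Balaban3D.Proofs.Constants (gammaMin_le)
open Summit.QuantumFields.Balaban3D.Proofs.Thresholds (gamma71L_spec sigma68_spec)
open Summit.QuantumFields.BalabanUV.T4Continuum.SubstrateBlockAvgContinuity (NestedSmall smallContinuous_expMeanLogSU)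
open Summit.QuantumFields.YangMills.Theorems.BalabanUVNodesN08AlphaGroupTopology
open Summit.QuantumFields.YangMills.Theorems.BalabanUVNodesN08AlphaArgClass (argClassC)
open Summit.QuantumFields.YangMills.Theorems.BalabanUVNodesN08AlphaRegSel (regClass)
open Summit.QuantumFields.YangMills.Theorems.BalabanUVNodesN08AlphaCompactSel (regClassC isClosed_regClassC regClassC_subset_regClass)
open Summit.QuantumFields.YangMills.Theorems.BalabanUVNodesN08AlphaClassIDischarge (projSite_corner_mem_Lam)
open Summit.QuantumFields.YangMills.Theorems.BalabanUVNodesN08AlphaB7AllScales (hcont_regClass)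
open Summit.QuantumFields.YangMills.Theorems.LocalSmallLoop (hull subset_hull depClosed_hull NestedSmallOn nestedSmall_subset_nestedSmallOn
  isClosed_nestedSmallOn continuousOn_iter_eval isClosed_nestedSmallOn_inter_plaqLe)
open B7Prop1Explicit (hol plaqWord e)
open B7Prop1Local (hol_plaqWord_eq)
open B7Prop2Explicit (avgIter C0 c2')

/-! ## §1 The [4]-window of `hcont_regClass` HOLDS on the record's window -/

section Window

variable (F : T3Family) (𝔠 : AlphaConsts F.L (suGroupModel 2).N) (γ : ℝ) (hγ : 0 < γ) (hγ1 : γ ≤ (min 𝔠.gamma0 1) ^ 2) (K : ℕ)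

/-- On the record's window every running coupling of the run is below the (71)-threshold: `g_j ≤ √γ ≤ min γ₀ 1 ≤ γ₀ ≤ γ₇₁` (`j ≤ K`).
[cite: Balaban1985UV3, (71) p.273] -/
theorem AlphaInputsT3AC.gk_le_gamma71_T3 {j : ℕ} (hj : j ≤ K) :
    (T3Scales F γ hγ (hγ1.trans (sq_min_one_le _ 𝔠.gamma0_pos)) K).gk j ≤ 𝔠.gamma71 := by
  have h1 := gk_le_gK (T3Scales F γ hγ (hγ1.trans (sq_min_one_le _ 𝔠.gamma0_pos)) K) j hj
  have h2 : (T3Scales F γ hγ (hγ1.trans (sq_min_one_le _ 𝔠.gamma0_pos)) K).g *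
      Real.sqrt (T3Scales F γ hγ (hγ1.trans (sq_min_one_le _ 𝔠.gamma0_pos)) K).ε₀ = Real.sqrt γ := by
    show Real.sqrt γ * Real.sqrt 1 = Real.sqrt γ
    rw [Real.sqrt_one, mul_one]
  have h3 : Real.sqrt γ ≤ min 𝔠.gamma0 1 := by
    have := Real.sqrt_le_sqrt hγ1
    rwa [Real.sqrt_sq (le_min 𝔠.gamma0_pos.le zero_le_one)] at this
  have h4 : 𝔠.gamma0 ≤ 𝔠.gamma71 := gammaMin_le (by simp)
  linarith [min_le_left 𝔠.gamma0 1]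

/-- **THE THREE [4]-WINDOW PREMISES OF `hcont_regClass` ON THE RECORD'S WINDOW** (`α_j := C68·g_jp(g_j)`, `j ≤ K`): `C₀(3)α_j ≤ ⅓`, `2α_j ≤ c₂′(3,L)`, and
`512·4·7·L²(α_j + 2C₀(3)α_j²) ≤ 1` — from `g_j ≤ γ₇₁ = γ(σ₆₈(C68, L))` (`Thresholds.gamma71L_spec`, `sigma68_spec`), the third from the first two as in
`…ProfileThreshold.windows_of_le_sigmaStruct`. [cite: Balaban1985Averaging, Prop. 2 (54) p.26; Balaban1985UV3, (71) p.273] -/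
theorem AlphaInputsT3AC.b7Window_T3 {j : ℕ} (hj : j ≤ K) :
    C0 3 * (𝔠.C68 * ((T3Scales F γ hγ (hγ1.trans (sq_min_one_le _ 𝔠.gamma0_pos)) K).gk j *
        pFun 𝔠.lane.carrier.b₀ 𝔠.lane.carrier.p₀ ((T3Scales F γ hγ (hγ1.trans (sq_min_one_le _ 𝔠.gamma0_pos)) K).gk j))) ≤ 1 / 3 ∧
    2 * (𝔠.C68 * ((T3Scales F γ hγ (hγ1.trans (sq_min_one_le _ 𝔠.gamma0_pos)) K).gk j *
        pFun 𝔠.lane.carrier.b₀ 𝔠.lane.carrier.p₀ ((T3Scales F γ hγ (hγ1.trans (sq_min_one_le _ 𝔠.gamma0_pos)) K).gk j))) ≤ c2' 3 F.L ∧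
    512 * (((3 : ℕ) : ℝ) + 1) * ((3 : ℕ) + 4) * (F.L : ℝ) ^ 2 *
      ((𝔠.C68 * ((T3Scales F γ hγ (hγ1.trans (sq_min_one_le _ 𝔠.gamma0_pos)) K).gk j *
          pFun 𝔠.lane.carrier.b₀ 𝔠.lane.carrier.p₀ ((T3Scales F γ hγ (hγ1.trans (sq_min_one_le _ 𝔠.gamma0_pos)) K).gk j))) +
        2 * C0 3 * (𝔠.C68 * ((T3Scales F γ hγ (hγ1.trans (sq_min_one_le _ 𝔠.gamma0_pos)) K).gk j *
          pFun 𝔠.lane.carrier.b₀ 𝔠.lane.carrier.p₀ ((T3Scales F γ hγ (hγ1.trans (sq_min_one_le _ 𝔠.gamma0_pos)) K).gk j))) ^ 2) ≤ 1 := by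
  set g : ℝ := (T3Scales F γ hγ (hγ1.trans (sq_min_one_le _ 𝔠.gamma0_pos)) K).gk j with hg
  have hg0 : 0 < g := gk_pos _ j
  have hL1 : 1 ≤ F.L := le_of_lt F.hL.2
  have hσ : g * pFun 𝔠.lane.carrier.b₀ 𝔠.lane.carrier.p₀ g ≤ Summit.QuantumFields.Balaban3D.Proofs.Thresholds.sigma68 𝔠.C68 F.L :=
    gamma71L_spec 𝔠.C68_pos hL1 𝔠.b₀_pos 𝔠.p₀_pos hg0 (AlphaInputsT3AC.gk_le_gamma71_T3 F 𝔠 γ hγ hγ1 K hj)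
  obtain ⟨hα3, hα2, -, -⟩ := sigma68_spec 𝔠.C68_pos hσ
  set α : ℝ := 𝔠.C68 * (g * pFun 𝔠.lane.carrier.b₀ 𝔠.lane.carrier.p₀ g) with hα
  have hC := B7Prop2Explicit.C0_pos 3
  have hαnn : 0 ≤ α := by
    have hp : 0 < pFun 𝔠.lane.carrier.b₀ 𝔠.lane.carrier.p₀ g := pFun_pos _ _ _ 𝔠.b₀_pos hg0 (gk_le_one _ (by
      show Real.sqrt γ ^ 2 * 1 ≤ 1
      rw [mul_one, Real.sq_sqrt hγ.le]; exact hγ1.trans (sq_min_one_le _ 𝔠.gamma0_pos)) j hj)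
    rw [hα]; exact mul_nonneg 𝔠.C68_pos.le (mul_nonneg hg0.le hp.le)
  refine ⟨hα3, hα2, ?_⟩
  -- `D := 512·4·7·L²`, `c₂′ = 1/D`, `Dα ≤ ½`, `D(α + 2C₀α²) = Dα + 2(Dα)(C₀α) ≤ ½ + ⅓ ≤ 1`
  set D : ℝ := 512 * (((3 : ℕ) : ℝ) + 1) * ((3 : ℕ) + 4) * (F.L : ℝ) ^ 2 with hD
  have hLr : (1 : ℝ) ≤ F.L := by exact_mod_cast hL1
  have hDpos : 0 < D := by rw [hD]; positivity
  have hc2 : c2' 3 F.L = 1 / D := by rw [hD]; unfold c2'; norm_num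
  have hDα : D * α ≤ 1 / 2 := by
    rw [hc2, le_div_iff₀ hDpos] at hα2
    linarith
  have hprod : D * α * (C0 3 * α) ≤ 1 / 2 * (1 / 3) := mul_le_mul hDα hα3 (by positivity) (by norm_num)
  show D * (α + 2 * C0 3 * α ^ 2) ≤ 1
  nlinarith

end Window

/-! ## §2 The read bonds, their dependency hull, and the localised adapted class -/

section T3

variable (F : T3Family) (𝔠 : AlphaConsts F.L (suGroupModel 2).N) (γ : ℝ) (hγ : 0 < γ) (hγ1 : γ ≤ (min 𝔠.gamma0 1) ^ 2) (K : ℕ)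

/-- **THE READ BONDS OF THE v3 ROWS AT `(k, h)`**: the bonds of `T^{(s)}` inside `Λ_i(h)` (`lam42 Ω(h) k i = Ω_i∖Ω_{i+1}` for `i < k`, `Ω_k` for `i = k`) for some
`s ≤ i ≤ k` — the bonds read by row r2 ((42)-top: `bondsIn k Ω_k(h)`, `lam42_self`) and by row r3 ((68) multi-level: the boundaries of `plaqsIn s (lam42 … k i)`,
`mem_bondsIn_of_mem_plaqsIn`). [cite: Balaban1985UV3, (42) p.266 + (68) p.273] -/
def AlphaInputsT3AC.readBondsT3 (k : ℕ) (h : Hist (F.P K) k) : (s : ℕ) → Set (PBond (F.P K) s) :=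
  fun s => {b | ∃ i, s ≤ i ∧ i ≤ k ∧ b ∈ bondsIn s (lam42 (Omega 𝔠.lane.carrier.M₁
    (rcolOf (T3Scales F γ hγ (hγ1.trans (sq_min_one_le _ 𝔠.gamma0_pos)) K) 𝔠.lane.carrier) k h) k i)}

/-- **THE DEPENDENCY CONES `E(k, h)` OF THE READ BONDS**: their dependency hull under the locality relation of the block averaging (`LocalSmallLoop.hull`).
[cite: Balaban1985Averaging, (15) p.19] -/
def AlphaInputsT3AC.coneT3 (k : ℕ) (h : Hist (F.P K) k) : (s : ℕ) → Set (PBond (F.P K) s) :=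
  hull (AlphaInputsT3AC.readBondsT3 F 𝔠 γ hγ hγ1 K k h)

/-- **THE LOCALISED SMALL-LOOP CLASS OF `(k, h)`**: the (0.4) loop variables of the averages of record of levels `< k` within `δ/2`, AT THE BONDS OF THE CONES
`E(k, h)` only (`LocalSmallLoop.NestedSmallOn`). [cite: Balaban1987RG1, (0.4) p.253] -/
def AlphaInputsT3AC.localSmallT3 (k : ℕ) (h : Hist (F.P K) k) : Set (GaugeField (F.P K) 0 (Matrix.specialUnitaryGroup (Fin 2) ℂ)) :=
  NestedSmallOn ℰp (ℰp.δ / 2) (AlphaInputsT3AC.coneT3 F 𝔠 γ hγ hγ1 K k h) k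

/-- **THE LOCALISED ADAPTED CLASS `𝒞_L(k, h, W)`**: the finest-lattice configurations in the localised small-loop class of `(k, h)`, in [7]'s closed regular class
`regClassC` ((68) at half the constant), (67)-large at the history's recorded plaquettes, and — when the datum is CHARGED — satisfying the top constraint (42) on
`Ω_k(h)` and the multi-level regularity r3.  No `argClassC` conjunct.  CLOSED at admissible `h`, `k ≤ K` (`isClosed_adaptedClassT3L_core` + §4).
[cite: Balaban1985UV3, (42) p.266 + (67)–(68) p.273] -/
def AlphaInputsT3AC.adaptedClassT3L (k : ℕ) (h : Hist (F.P K) k) (W : GaugeField (F.P K) k (Matrix.specialUnitaryGroup (Fin 2) ℂ)) :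
    Set (GaugeField (F.P K) 0 (Matrix.specialUnitaryGroup (Fin 2) ℂ)) :=
  {U | U ∈ AlphaInputsT3AC.localSmallT3 F 𝔠 γ hγ hγ1 K k h ∧
    U ∈ regClassC (S := T3Scales F γ hγ (hγ1.trans (sq_min_one_le _ 𝔠.gamma0_pos)) K) (suGroupModel 2) 𝔠 k h ∧
    U ∈ AlphaInputsT3AC.large67Set F 𝔠 γ hγ hγ1 K k h ∧
    (ChargedT3 F γ 𝔠.b₀ 𝔠.p₀ (avgWindowFactor F.L) K 𝔠.lane.carrier.M₁
        (rcolOf (T3Scales F γ hγ (hγ1.trans (sq_min_one_le _ 𝔠.gamma0_pos)) K) 𝔠.lane.carrier) k h W →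
      U ∈ AlphaInputsT3AC.top42Set F 𝔠 γ hγ hγ1 K k h W ∧ U ∈ AlphaInputsT3AC.reg68LevelsSet F 𝔠 γ hγ hγ1 K k h)}

variable {F 𝔠 γ hγ hγ1 K}

/-- Unfolding membership in the localised adapted class. [folklore] -/
theorem AlphaInputsT3AC.mem_adaptedClassT3L_iff {k : ℕ} {h : Hist (F.P K) k} {W : GaugeField (F.P K) k (Matrix.specialUnitaryGroup (Fin 2) ℂ)}
    {U : GaugeField (F.P K) 0 (Matrix.specialUnitaryGroup (Fin 2) ℂ)} :
    U ∈ AlphaInputsT3AC.adaptedClassT3L F 𝔠 γ hγ hγ1 K k h W ↔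
      U ∈ AlphaInputsT3AC.localSmallT3 F 𝔠 γ hγ hγ1 K k h ∧
      U ∈ regClassC (S := T3Scales F γ hγ (hγ1.trans (sq_min_one_le _ 𝔠.gamma0_pos)) K) (suGroupModel 2) 𝔠 k h ∧
      U ∈ AlphaInputsT3AC.large67Set F 𝔠 γ hγ hγ1 K k h ∧
      (ChargedT3 F γ 𝔠.b₀ 𝔠.p₀ (avgWindowFactor F.L) K 𝔠.lane.carrier.M₁
          (rcolOf (T3Scales F γ hγ (hγ1.trans (sq_min_one_le _ 𝔠.gamma0_pos)) K) 𝔠.lane.carrier) k h W →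
        U ∈ AlphaInputsT3AC.top42Set F 𝔠 γ hγ hγ1 K k h W ∧ U ∈ AlphaInputsT3AC.reg68LevelsSet F 𝔠 γ hγ hγ1 K k h) :=
  Iff.rfl

/-- **`𝒞 ⊆ 𝒞_L`**: g0's adapted class lies in the localised one (the global small-loop class lies in every localised class; the `argClassC` conjunct is dropped) —
so g0's displayed (D6) implies the localised (D6L). [cite: Balaban1987RG1, (0.4) p.253] -/
theorem AlphaInputsT3AC.adaptedClassT3_subset_adaptedClassT3L (k : ℕ) (h : Hist (F.P K) k) (W : GaugeField (F.P K) k (Matrix.specialUnitaryGroup (Fin 2) ℂ)) :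
    AlphaInputsT3AC.adaptedClassT3 F 𝔠 γ hγ hγ1 K k h W ⊆ AlphaInputsT3AC.adaptedClassT3L F 𝔠 γ hγ hγ1 K k h W := by
  intro U hU
  obtain ⟨hN, -, hReg, hL, hrel⟩ := hU
  exact ⟨nestedSmall_subset_nestedSmallOn (by show ℰp.δ / 2 < ℰp.δ; linarith [ℰp.δ_pos]) _ k hN, hReg, hL, hrel⟩

/-- The bonds of `Ω_k(h)` at level `k` (row r2's bonds) are read bonds. [cite: Balaban1985UV3, (42) p.266] -/
theorem AlphaInputsT3AC.mem_readBondsT3_top {k : ℕ} {h : Hist (F.P K) k} {b : PBond (F.P K) k}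
    (hb : b ∈ bondsIn k (Omega 𝔠.lane.carrier.M₁ (rcolOf (T3Scales F γ hγ (hγ1.trans (sq_min_one_le _ 𝔠.gamma0_pos)) K) 𝔠.lane.carrier) k h k)) :
    b ∈ AlphaInputsT3AC.readBondsT3 F 𝔠 γ hγ hγ1 K k h k :=
  ⟨k, le_rfl, le_rfl, by rwa [lam42_self]⟩

/-- The four bonds of a plaquette of row r3 (`q ∈ plaqsIn s (lam42 … k i)`, `s ≤ i ≤ k`) are read bonds. [cite: Balaban1985UV3, (68) p.273] -/
theorem AlphaInputsT3AC.plaqBonds_mem_readBondsT3 {k : ℕ} {h : Hist (F.P K) k} {i s : ℕ} (hi : i ≤ k) (hs : s ≤ i) {q : Plaq (F.P K) s}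
    (hq : q ∈ plaqsIn s (lam42 (Omega 𝔠.lane.carrier.M₁
      (rcolOf (T3Scales F γ hγ (hγ1.trans (sq_min_one_le _ 𝔠.gamma0_pos)) K) 𝔠.lane.carrier) k h) k i)) :
    (⟨q.src, q.μ⟩ : PBond (F.P K) s) ∈ AlphaInputsT3AC.readBondsT3 F 𝔠 γ hγ hγ1 K k h s ∧
      (⟨q.src.shift q.μ, q.ν⟩ : PBond (F.P K) s) ∈ AlphaInputsT3AC.readBondsT3 F 𝔠 γ hγ hγ1 K k h s ∧
      (⟨q.src.shift q.ν, q.μ⟩ : PBond (F.P K) s) ∈ AlphaInputsT3AC.readBondsT3 F 𝔠 γ hγ hγ1 K k h s ∧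
      (⟨q.src, q.ν⟩ : PBond (F.P K) s) ∈ AlphaInputsT3AC.readBondsT3 F 𝔠 γ hγ hγ1 K k h s := by
  obtain ⟨h1, h2, h3, h4⟩ := mem_bondsIn_of_mem_plaqsIn hq
  exact ⟨⟨i, hs, hi, h1⟩, ⟨i, hs, hi, h2⟩, ⟨i, hs, hi, h3⟩, ⟨i, hs, hi, h4⟩⟩

/-! ## §3 Topology: the core is closed at admissible histories -/

/-- The run's steps are in the standing range of the family: `k ≤ K ⇒ k ≤ m + K`. [folklore] -/
theorem AlphaInputsT3AC.le_standing_of_le {k : ℕ} (hk : k ≤ K) : k ≤ (F.P K).m + (F.P K).K := by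
  show k ≤ F.m + K; omega

/-- **THE LOCALISED SMALL-LOOP CLASS IS CLOSED** (`k ≤ K`; `LocalSmallLoop.isClosed_nestedSmallOn` at `ℰp`, margin `δ/2 < δ`, the cones dependency-closed).
[cite: Balaban1987RG1, (0.4) p.253] -/
theorem AlphaInputsT3AC.isClosed_localSmallT3 {k : ℕ} (hk : k ≤ K) (h : Hist (F.P K) k) :
    IsClosed (AlphaInputsT3AC.localSmallT3 F 𝔠 γ hγ hγ1 K k h) :=
  isClosed_nestedSmallOn AlphaInputsT3AC.continuous_dist1_su2 smallContinuous_expMeanLogSU (by show ℰp.δ / 2 < ℰp.δ; linarith [ℰp.δ_pos])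
    (depClosed_hull _) (AlphaInputsT3AC.le_standing_of_le hk)

/-- On the localised class the `s`-fold average of record is continuous at every read bond, `s ≤ k ≤ K`. [cite: Balaban1987RG1, (0.4) p.253] -/
theorem AlphaInputsT3AC.continuousOn_iter_readBond {k : ℕ} (hk : k ≤ K) (h : Hist (F.P K) k) {s : ℕ} (hs : s ≤ k) {b : PBond (F.P K) s}
    (hb : b ∈ AlphaInputsT3AC.readBondsT3 F 𝔠 γ hγ hγ1 K k h s) :
    ContinuousOn (fun U : GaugeField (F.P K) 0 (Matrix.specialUnitaryGroup (Fin 2) ℂ) =>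
      Averaging.iter (fun l => BlockAveraging.blockAvg (P := F.P K) (j := l) ℰp) s U b) (AlphaInputsT3AC.localSmallT3 F 𝔠 γ hγ hγ1 K k h) :=
  continuousOn_iter_eval AlphaInputsT3AC.continuous_dist1_su2 smallContinuous_expMeanLogSU (by show ℰp.δ / 2 < ℰp.δ; linarith [ℰp.δ_pos])
    (depClosed_hull _) (AlphaInputsT3AC.le_standing_of_le hk) hs (subset_hull _ s hb)

/-- **THE r3 SET IS CLOSED RELATIVE TO THE LOCALISED CLASS** (every plaquette it reads has its four bonds among the read bonds). [cite: Balaban1985UV3, (68) p.273] -/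
theorem AlphaInputsT3AC.isClosed_localSmallT3_inter_reg68LevelsSet {k : ℕ} (hk : k ≤ K) (h : Hist (F.P K) k) :
    IsClosed (AlphaInputsT3AC.localSmallT3 F 𝔠 γ hγ hγ1 K k h ∩ AlphaInputsT3AC.reg68LevelsSet F 𝔠 γ hγ hγ1 K k h) := by
  refine AlphaInputsT3AC.isClosed_inter_setOf_forall_imp (AlphaInputsT3AC.isClosed_localSmallT3 hk h) fun i hi => ?_
  refine AlphaInputsT3AC.isClosed_inter_setOf_forall_imp (AlphaInputsT3AC.isClosed_localSmallT3 hk h) fun s hs => ?_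
  refine AlphaInputsT3AC.isClosed_inter_setOf_forall_imp (AlphaInputsT3AC.isClosed_localSmallT3 hk h) fun q hq => ?_
  obtain ⟨h₁, h₂, h₃, h₄⟩ := AlphaInputsT3AC.plaqBonds_mem_readBondsT3 (F := F) (𝔠 := 𝔠) (hγ1 := hγ1) hi hs hq
  exact isClosed_nestedSmallOn_inter_plaqLe AlphaInputsT3AC.continuous_dist1_su2 smallContinuous_expMeanLogSU
    (by show ℰp.δ / 2 < ℰp.δ; linarith [ℰp.δ_pos]) (depClosed_hull _) (AlphaInputsT3AC.le_standing_of_le hk) (hs.trans hi) q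
    (subset_hull _ s h₁) (subset_hull _ s h₂) (subset_hull _ s h₃) (subset_hull _ s h₄) _

/-- Inversion of units of a complete normed ring is continuous along a set where the unit-valued map is. [folklore] -/
theorem AlphaInputsT3AC.continuousOn_val_inv {X : Type*} [TopologicalSpace X] {𝔸 : Type*} [NormedRing 𝔸] [CompleteSpace 𝔸]
    {f : X → 𝔸ˣ} {A : Set X} (hf : ContinuousOn (fun x => (f x : 𝔸)) A) : ContinuousOn (fun x => (((f x)⁻¹ : 𝔸ˣ) : 𝔸)) A := by
  have heq : (fun x => (((f x)⁻¹ : 𝔸ˣ) : 𝔸)) = Ring.inverse ∘ fun x => (f x : 𝔸) := funext fun x => (Ring.inverse_unit (f x)).symm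
  rw [heq]
  exact fun x hx => ContinuousAt.comp_continuousWithinAt (f := fun y => (f y : 𝔸)) (x := x) (NormedRing.inverse_continuousAt (f x)) (hf x hx)

/-- **THE LIFTED [4]-AVERAGES ARE CONTINUOUS ON [7]'S OPEN CLASS AT THE BONDS OF `Λ_j(h)`** — the T³ instance of NODE O's `hcont_regClass` ([Balaban1985Averaging]
Prop. 2 with its printed locality), its three window premises supplied by §1 on the record's window. [cite: Balaban1985Averaging, Prop. 2 (54) p.26 + (42)–(43) pp.23–24] -/
theorem AlphaInputsT3AC.continuousOn_liftAvg_regClass_T3 {k : ℕ} (hk : k ≤ K) (h : Hist (F.P K) k) {j : ℕ} (hj : j < k)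
    (z : B7Prop1Explicit.Site (F.P K).d) (κ : Fin (F.P K).d)
    (hz : projSite (((F.L : ℤ) ^ j) • z) ∈ Lam 𝔠.lane.carrier.M₁ (rcolOf (T3Scales F γ hγ (hγ1.trans (sq_min_one_le _ 𝔠.gamma0_pos)) K) 𝔠.lane.carrier) h j)
    (hzκ : projSite (((F.L : ℤ) ^ j) • (z + e κ)) ∈
      Lam 𝔠.lane.carrier.M₁ (rcolOf (T3Scales F γ hγ (hγ1.trans (sq_min_one_le _ 𝔠.gamma0_pos)) K) 𝔠.lane.carrier) h j) :
    ContinuousOn (fun U : GaugeField (F.P K) 0 (Matrix.specialUnitaryGroup (Fin 2) ℂ) =>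
      ((avgIter F.L (liftCfg (S := T3Scales F γ hγ (hγ1.trans (sq_min_one_le _ 𝔠.gamma0_pos)) K) (suGroupModel 2) U) j z κ :
        (Matrix (Fin (suGroupModel 2).N) (Fin (suGroupModel 2).N) ℂ)ˣ) : Matrix (Fin (suGroupModel 2).N) (Fin (suGroupModel 2).N) ℂ))
      (regClass (S := T3Scales F γ hγ (hγ1.trans (sq_min_one_le _ 𝔠.gamma0_pos)) K) (suGroupModel 2) 𝔠 k h) := by
  have hL2 : 2 ≤ F.L := F.hL.2
  exact hcont_regClass (S := T3Scales F γ hγ (hγ1.trans (sq_min_one_le _ 𝔠.gamma0_pos)) K) (suGroupModel 2) 𝔠 hL2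
    (fun j' hj' => (AlphaInputsT3AC.b7Window_T3 F 𝔠 γ hγ hγ1 K hj'.le).1)
    (fun j' hj' => (AlphaInputsT3AC.b7Window_T3 F 𝔠 γ hγ hγ1 K hj'.le).2.1)
    (fun j' hj' => (AlphaInputsT3AC.b7Window_T3 F 𝔠 γ hγ hγ1 K hj'.le).2.2) k hk h j hj z κ hz hzκ

/-- **AT AN ADMISSIBLE HISTORY THE AVERAGED PLAQUETTE VARIABLE OF A RECORDED PLAQUETTE IS CONTINUOUS ON [7]'S OPEN CLASS**: the four bonds of `∂p′`,
`p′ ∈ P_j(h)`, have their end blocks in `Λ_j(h)` (`projSite_corner_mem_Lam`), where the lifted `j`-fold averages are continuous; the plaquette holonomy reads only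
them (`hol_plaqWord_eq`). [cite: Balaban1985UV3, (67) p.273 L13] -/
theorem AlphaInputsT3AC.continuousOn_hol_disc_regClass {k : ℕ} (hk : k ≤ K) {h : Hist (F.P K) k}
    (hh : Hist.Admissible 𝔠.lane.carrier.M₁ (rcolOf (T3Scales F γ hγ (hγ1.trans (sq_min_one_le _ 𝔠.gamma0_pos)) K) 𝔠.lane.carrier) k h)
    {q : ℕ × PlaqCode (F.P K)} (hq : q ∈ Hist.disc h) :
    ContinuousOn (fun U : GaugeField (F.P K) 0 (Matrix.specialUnitaryGroup (Fin 2) ℂ) =>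
      ((hol (avgIter F.L (liftCfg (S := T3Scales F γ hγ (hγ1.trans (sq_min_one_le _ 𝔠.gamma0_pos)) K) (suGroupModel 2) U) q.1)
          (codeZ q) (plaqWord q.2.2.1 q.2.2.2) : (Matrix (Fin (suGroupModel 2).N) (Fin (suGroupModel 2).N) ℂ)ˣ) :
          Matrix (Fin (suGroupModel 2).N) (Fin (suGroupModel 2).N) ℂ))
      (regClass (S := T3Scales F γ hγ (hγ1.trans (sq_min_one_le _ 𝔠.gamma0_pos)) K) (suGroupModel 2) 𝔠 k h) := by
  obtain ⟨j, hj, p, hp, hqj, hz, hμ, hν⟩ := decode_of_mem_disc (S := T3Scales F γ hγ (hγ1.trans (sq_min_one_le _ 𝔠.gamma0_pos)) K) hq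
  have hq1 : q.1 = j := by rw [hqj]
  rw [hq1, hz, hμ, hν]
  -- the four bonds of ∂p′ lie in Λ_j(h)
  have h01 : (0 : ℤ) ≤ 0 ∧ (0 : ℤ) ≤ 1 := ⟨le_rfl, zero_le_one⟩
  have h11 : (0 : ℤ) ≤ 1 ∧ (1 : ℤ) ≤ 1 := ⟨zero_le_one, le_rfl⟩
  have c00 := projSite_corner_mem_Lam (S := T3Scales F γ hγ (hγ1.trans (sq_min_one_le _ 𝔠.gamma0_pos)) K) hh hk hj hp 0 0 h01 h01
  have c10 := projSite_corner_mem_Lam (S := T3Scales F γ hγ (hγ1.trans (sq_min_one_le _ 𝔠.gamma0_pos)) K) hh hk hj hp 1 0 h11 h01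
  have c01 := projSite_corner_mem_Lam (S := T3Scales F γ hγ (hγ1.trans (sq_min_one_le _ 𝔠.gamma0_pos)) K) hh hk hj hp 0 1 h01 h11
  have c11 := projSite_corner_mem_Lam (S := T3Scales F γ hγ (hγ1.trans (sq_min_one_le _ 𝔠.gamma0_pos)) K) hh hk hj hp 1 1 h11 h11
  simp only [zero_smul, one_smul, add_zero] at c00 c10 c01 c11
  have b1 := AlphaInputsT3AC.continuousOn_liftAvg_regClass_T3 (𝔠 := 𝔠) (hγ1 := hγ1) hk h hj (zOf p) p.μ c00 c10
  have b2 := AlphaInputsT3AC.continuousOn_liftAvg_regClass_T3 (𝔠 := 𝔠) (hγ1 := hγ1) hk h hj (zOf p + e p.μ) p.ν c10 c11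
  have b3 := AlphaInputsT3AC.continuousOn_liftAvg_regClass_T3 (𝔠 := 𝔠) (hγ1 := hγ1) hk h hj (zOf p + e p.ν) p.μ c01 (by rwa [add_right_comm] at c11)
  have b4 := AlphaInputsT3AC.continuousOn_liftAvg_regClass_T3 (𝔠 := 𝔠) (hγ1 := hγ1) hk h hj (zOf p) p.ν c00 c01
  simp only [hol_plaqWord_eq, Units.val_mul]
  exact ((b1.mul b2).mul (AlphaInputsT3AC.continuousOn_val_inv b3)).mul (AlphaInputsT3AC.continuousOn_val_inv b4)

/-- **AT AN ADMISSIBLE HISTORY THE (67)-LARGENESS SET IS CLOSED RELATIVE TO [7]'S CLOSED REGULAR CLASS** (`k ≤ K`; no `argClassC`). [cite: Balaban1985UV3, (67) p.273] -/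
theorem AlphaInputsT3AC.isClosed_regClassC_inter_large67Set {k : ℕ} (hk : k ≤ K) {h : Hist (F.P K) k}
    (hh : Hist.Admissible 𝔠.lane.carrier.M₁ (rcolOf (T3Scales F γ hγ (hγ1.trans (sq_min_one_le _ 𝔠.gamma0_pos)) K) 𝔠.lane.carrier) k h) :
    IsClosed (regClassC (S := T3Scales F γ hγ (hγ1.trans (sq_min_one_le _ 𝔠.gamma0_pos)) K) (suGroupModel 2) 𝔠 k h ∩
      AlphaInputsT3AC.large67Set F 𝔠 γ hγ hγ1 K k h) := by
  have hC := isClosed_regClassC (S := T3Scales F γ hγ (hγ1.trans (sq_min_one_le _ 𝔠.gamma0_pos)) K) (suGroupModel 2) 𝔠 k h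
  refine AlphaInputsT3AC.isClosed_inter_setOf_forall hC (Hist.disc h) fun q hq => ?_
  have hcont := ((AlphaInputsT3AC.continuousOn_hol_disc_regClass (𝔠 := 𝔠) (hγ1 := hγ1) hk hh hq).mono
    (regClassC_subset_regClass (S := T3Scales F γ hγ (hγ1.trans (sq_min_one_le _ 𝔠.gamma0_pos)) K) (suGroupModel 2) 𝔠 hk h)).sub
    (continuousOn_const (c := (1 : Matrix (Fin (suGroupModel 2).N) (Fin (suGroupModel 2).N) ℂ)))
  exact hcont.norm.preimage_isClosed_of_isClosed hC isClosed_Ici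

/-- **THE W-INDEPENDENT CORE OF `𝒞_L` IS CLOSED** at an admissible history, `k ≤ K`: localised small-loop class ∩ (closed regular class ∩ (67)-largeness).
[cite: Balaban1985UV3, (67)–(68) p.273] -/
theorem AlphaInputsT3AC.isClosed_adaptedCoreL {k : ℕ} (hk : k ≤ K) {h : Hist (F.P K) k}
    (hh : Hist.Admissible 𝔠.lane.carrier.M₁ (rcolOf (T3Scales F γ hγ (hγ1.trans (sq_min_one_le _ 𝔠.gamma0_pos)) K) 𝔠.lane.carrier) k h) :
    IsClosed (AlphaInputsT3AC.localSmallT3 F 𝔠 γ hγ hγ1 K k h ∩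
      (regClassC (S := T3Scales F γ hγ (hγ1.trans (sq_min_one_le _ 𝔠.gamma0_pos)) K) (suGroupModel 2) 𝔠 k h ∩
        AlphaInputsT3AC.large67Set F 𝔠 γ hγ hγ1 K k h)) :=
  (AlphaInputsT3AC.isClosed_localSmallT3 hk h).inter (AlphaInputsT3AC.isClosed_regClassC_inter_large67Set (𝔠 := 𝔠) (hγ1 := hγ1) hk hh)

end T3

end Summit.QuantumFields.YangMills.Theorems

end
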